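import Mathlib.Computability.Encoding
import Mathlib.Computability.Language
import Literature.Computability.Complexity.BoolEncodings
import Literature.Computability.Complexity.Circuit
import Literature.Computability.Complexity.Classes
import Literature.Computability.Complexity.Nondeterministic
import Literature.Computability.Complexity.Promise
import Literature.Computability.MetaComplexity.TruthTables
import HarnessLib

-- provenance: harness21/H21/H21/Prelude/CplxMeta/MCSP.lean @ 1293438 (interim HEAD d8f2665); M5 mechanical rewrite
/-!
# Complexity meta: the Minimum Circuit Size Problem

Trunk `CplxMeta` (G14), concept C5 / design decision D5 of `H21/Outlines/CplxMeta.md`; realises the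
notion `mcsp_language`.

The *Minimum Circuit Size Problem* `MCSP` (Kabanets–Cai 2000, §2) asks, given the truth table
`tt(f) ∈ {0,1}^{2ⁿ}` of a Boolean function `f : {0,1}ⁿ → {0,1}` and a size parameter `s ∈ ℕ`,
whether `f` has a circuit of size at most `s`. We provide

* `MCSP : Language Bool` — instances `⟨tt(f), s⟩` paired by G01's `boolPair`, `s` in binary
  (`Computability.encodeNat`); yes iff `circuitSizeOver B2 f ≤ s` (Kabanets–Cai 2000, §2);
* `MCSPSize s : Language Bool` — the parametrised version `MCSP[s]`, whose instances are bare truth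
  tables and the threshold `s(n)` is a function of the arity (Kabanets–Cai 2000, §2;
  Murray–Williams 2017, §1);
* `MCSPStar : Language Bool` — `MCSP*`, the partial-function variant (Hirahara, FOCS 2022, §1):
  the instance is a partial truth table `T : {0,1}ⁿ → {0,1,⋆}` and a size bound `s`, and one asks
  for a circuit of size `≤ s` agreeing with `T` wherever `T` is defined;
* `gapMCSP a b : PromiseProblem` — the gap version with yes-instances `MCSP[a]` and no-instances
  the truth tables of functions of circuit complexity `> b(n)` (Allender–Hirahara 2019, §2;
  Allender–Ilango–Vafa 2023, §1);
* API: `truthTable_mem_MCSPSize_iff`, `MCSPSize_mono`, `boolPair_truthTable_mem_MCSP_iff`,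
  `gapMCSP_disjoint`, and the (sorried, textbook) memberships `MCSP_mem_NP`, `MCSPStar_mem_NP`.

Design choices.
* Circuit size is G01's `circuitSizeOver B2` (all fan-in-`≤ 2` gates counted, full binary basis
  `B2`); the cited results are robust under the choice of complete basis (D5). By
  `exists_computes_B2` the `sInf` in `circuitSizeOver B2 f` is never the junk value `0`.
* `search-MCSP` (output a minimum circuit) is **not** defined: it would need a canonical
  `Computability.Encoding (Circuit (Fin n)) Bool`, which G01 deliberately omits (G01 R6).
* In `MCSPStar` the arity `n` is not part of the instance: it is determined by the length `2ⁿ` of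
  the encoded list (`Nat.pow_right_injective`); strings whose first component is not the
  `listBool` code of a list of power-of-two length lie outside the language.
* Mathlib has no `MCSP`, truth-table language or circuit-size problem (searched `MCSP`,
  `CircuitSize`, `truthTable`); pairing/number/option/list encodings are G01's `boolPair`,
  Mathlib's `encodeNat`/`encodingBoolBool` and G01's `Encoding.optionBool`/`Encoding.listBool`.
-/

namespace Literature.Computability.MetaComplexity

open _root_.Computability Complexity Complexity.Nondeterministic

variable {n : ℕ}

/-! ### The languages -/

/-- The *Minimum Circuit Size Problem* `MCSP ⊆ {0,1}*`: the set of strings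
`boolPair (tt f) (encodeNat s)` where `f : {0,1}ⁿ → {0,1}` (any `n`), `s ∈ ℕ` is given in binary,
and `f` is computed by some circuit over the full binary basis `B2` of size at most `s`, i.e.
`circuitSizeOver B2 f ≤ s` (Kabanets–Cai 2000, §2, "MCSP"; Arora–Barak 2009, Ex. 6.6). [cite: KabanetsCai2000, §2  "MCSP"] -/
def MCSP : Language Bool :=
  {w | ∃ (n : ℕ) (f : (Fin n → Bool) → Bool) (s : ℕ),
    w = boolPair (truthTable f) (encodeNat s) ∧ circuitSizeOver B2 f ≤ s}

/-- The parametrised Minimum Circuit Size Problem `MCSP[s] ⊆ {0,1}*` for a size function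
`s : ℕ → ℕ`: the set of truth tables `tt f` of functions `f : {0,1}ⁿ → {0,1}` (any `n`) with
`circuitSizeOver B2 f ≤ s n` (Kabanets–Cai 2000, §2; Murray–Williams 2017, §1, "MCSP[s(n)]").
Strings whose length is not a power of two are never in the language. [cite: KabanetsCai2000, §2] -/
def MCSPSize (s : ℕ → ℕ) : Language Bool :=
  {w | ∃ (n : ℕ) (f : (Fin n → Bool) → Bool), w = truthTable f ∧ circuitSizeOver B2 f ≤ s n}

/-- The *partial-function* Minimum Circuit Size Problem `MCSP* ⊆ {0,1}*` (Hirahara, "NP-hardness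
of learning programs and partial MCSP", FOCS 2022, §1.1): instances are
`boolPair (enc T) (encodeNat s)` where `T : Fin (2ⁿ) → Option Bool` is a partial truth table
(`none` = "don't care", listed in the order `boolFunEquivFin n` and encoded with
`(encodingBoolBool.optionBool).listBool`) and `s ∈ ℕ`; yes iff some circuit `C` over `B2` on `n`
inputs of size `≤ s` satisfies `C(x) = b` whenever `T(x) = some b`. The arity `n` is determined
by the list length `2ⁿ` (`Nat.pow_right_injective`); strings whose first component does not
encode a list of power-of-two length are outside the language. [cite: FOCS2022, §1.1] -/
def MCSPStar : Language Bool :=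
  {w | ∃ (n : ℕ) (T : Fin (2 ^ n) → Option Bool) (s : ℕ),
    w = boolPair ((encodingBoolBool.optionBool).listBool.encode (List.ofFn T)) (encodeNat s) ∧
    ∃ C : Circuit (Fin n), C.IsOver B2 ∧ C.size ≤ s ∧
      ∀ (i : Fin (2 ^ n)) (b : Bool), T i = some b → C.eval ((boolFunEquivFin n).symm i) = b}

/-- The gap version `MCSP[a, b]` of the Minimum Circuit Size Problem as a promise problem:
yes-instances are truth tables of functions with `circuitSizeOver B2 f ≤ a n` (i.e. `MCSP[a]`),
no-instances are truth tables of functions with `b n < circuitSizeOver B2 f`. Intended for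
`a ≤ b`, when the two parts are disjoint (`gapMCSP_disjoint`) (Allender–Hirahara 2019, §2,
"Gap MCSP"; Allender–Ilango–Vafa 2023, §1). [cite: AllenderHirahara2019, §2  "Gap MCSP"] -/
def gapMCSP (a b : ℕ → ℕ) : PromiseProblem :=
  ⟨MCSPSize a,
    {w | ∃ (n : ℕ) (f : (Fin n → Bool) → Bool), w = truthTable f ∧ b n < circuitSizeOver B2 f}⟩

/-! ### Basic API -/

/-- `MCSP[s]` is the truth-table language (`truthTableLanguage`) of the combinatorial property
"`circuitSizeOver B2 f ≤ s n`" (by definition; Kabanets–Cai 2000, §2). [cite: KabanetsCai2000, §2] -/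
theorem MCSPSize_eq_truthTableLanguage (s : ℕ → ℕ) :
    MCSPSize s = truthTableLanguage fun n => {f | circuitSizeOver B2 f ≤ s n} := rfl

/-- The no-part of `gapMCSP a b` is the truth-table language of "`b n < circuitSizeOver B2 f`"
(by definition; Allender–Hirahara 2019, §2). [cite: AllenderHirahara2019, §2] -/
theorem gapMCSP_no_eq_truthTableLanguage (a b : ℕ → ℕ) :
    (gapMCSP a b).no = truthTableLanguage fun n => {f | b n < circuitSizeOver B2 f} := rfl

/-- The yes-part of `gapMCSP a b` is `MCSP[a]` (by definition; Allender–Hirahara 2019, §2). [cite: AllenderHirahara2019, §2] -/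
@[simp] theorem gapMCSP_yes (a b : ℕ → ℕ) : (gapMCSP a b).yes = MCSPSize a := rfl

/-- A truth table `tt f` of an `n`-variable function lies in `MCSP[s]` iff
`circuitSizeOver B2 f ≤ s n` (the length `2ⁿ` determines `n` and `truthTable` is injective)
(Kabanets–Cai 2000, §2). [cite: KabanetsCai2000, §2] -/
@[simp] theorem truthTable_mem_MCSPSize_iff (s : ℕ → ℕ) (f : (Fin n → Bool) → Bool) :
    truthTable f ∈ MCSPSize s ↔ circuitSizeOver B2 f ≤ s n := by
  rw [MCSPSize_eq_truthTableLanguage, truthTable_mem_truthTableLanguage_iff]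
  rfl

/-- A truth table `tt f` lies in the no-part of `gapMCSP a b` iff `b n < circuitSizeOver B2 f`
(Allender–Hirahara 2019, §2). [cite: AllenderHirahara2019, §2] -/
@[simp] theorem truthTable_mem_gapMCSP_no_iff (a b : ℕ → ℕ) (f : (Fin n → Bool) → Bool) :
    truthTable f ∈ (gapMCSP a b).no ↔ b n < circuitSizeOver B2 f := by
  rw [gapMCSP_no_eq_truthTableLanguage, truthTable_mem_truthTableLanguage_iff]
  rfl

/-- `MCSP[s]` is monotone in the size bound: `s ≤ s'` pointwise implies `MCSP[s] ⊆ MCSP[s']`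
(Kabanets–Cai 2000, §2). [cite: KabanetsCai2000, §2] -/
theorem MCSPSize_mono {s s' : ℕ → ℕ} (h : ∀ n, s n ≤ s' n) : MCSPSize s ≤ MCSPSize s' := by
  rintro w ⟨n, f, rfl, hf⟩
  exact ⟨n, f, rfl, hf.trans (h n)⟩

/-- The instance `⟨tt f, s⟩` lies in `MCSP` iff `circuitSizeOver B2 f ≤ s` (injectivity of
`boolPair`, `truthTable` and `encodeNat`) (Kabanets–Cai 2000, §2). [cite: KabanetsCai2000, §2] -/
@[simp] theorem boolPair_truthTable_mem_MCSP_iff (f : (Fin n → Bool) → Bool) (s : ℕ) :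
    boolPair (truthTable f) (encodeNat s) ∈ MCSP ↔ circuitSizeOver B2 f ≤ s := by
  constructor
  · rintro ⟨m, g, s', hw, hg⟩
    have h := congrArg boolUnpair hw
    simp only [boolUnpair_boolPair, Prod.mk.injEq] at h
    obtain ⟨hfg, hs⟩ := h
    have hlen := congrArg List.length hfg
    simp only [length_truthTable] at hlen
    obtain rfl : n = m := Nat.pow_right_injective le_rfl hlen
    obtain rfl : f = g := truthTable_injective hfg
    have hs' : s = s' := by simpa using congrArg decodeNat hs
    exact hs' ▸ hg
  · intro hf
    exact ⟨n, f, s, rfl, hf⟩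

/-- For `a ≤ b` pointwise, the gap problem `gapMCSP a b` is a genuine (disjoint) promise problem:
no truth table has circuit complexity both `≤ a n` and `> b n` (Allender–Hirahara 2019, §2). [cite: AllenderHirahara2019, §2] -/
theorem gapMCSP_disjoint {a b : ℕ → ℕ} (h : ∀ n, a n ≤ b n) : (gapMCSP a b).Disjoint := by
  refine Set.disjoint_left.2 ?_
  rintro w ⟨n, f, rfl, hf⟩ hno
  have hno' : b n < circuitSizeOver B2 f := (truthTable_mem_gapMCSP_no_iff a b f).1 hno
  exact absurd (hf.trans (h n)) (not_le.mpr hno')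

/-- A total truth table, viewed as a partial one with no "don't care" entries, is a yes-instance
of `MCSP*` iff it is a yes-instance of `MCSP`: `⟨enc (some ∘ tt f), s⟩ ∈ MCSP*` iff
`circuitSizeOver B2 f ≤ s` (Hirahara 2022, §1.1: `MCSP` is the special case of `MCSP*` with no
`⋆`). [cite: Hirahara2022, §1.1:  MCSP  is the special case of  MCS] -/
def boolPair_encode_some_mem_MCSPStar_iff : Prop :=
  ∀ (f : (Fin n → Bool) → Bool) (s : ℕ),
    boolPair ((encodingBoolBool.optionBool).listBool.encode
        (List.ofFn fun i : Fin (2 ^ n) => some (f ((boolFunEquivFin n).symm i)))) (encodeNat s) ∈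
      MCSPStar ↔ circuitSizeOver B2 f ≤ s

/- interim proof relied on results that are now named facts (D-0014); demoted to a fact by the M5 import, proof preserved:
:= by
  constructor
  · rintro ⟨m, T, s', hw, C, hC, hsize, hT⟩
    have h := congrArg boolUnpair hw
    simp only [boolUnpair_boolPair, Prod.mk.injEq] at h
    obtain ⟨hfT, hs⟩ := h
    have hs' : s = s' := by simpa using congrArg decodeNat hs
    subst hs'
    have hl := (encodingBoolBool.optionBool).listBool.encode_injective hfT
    have hlen := congrArg List.length hl
    simp only [List.length_ofFn] at hlen
    obtain rfl : n = m := Nat.pow_right_injective le_rfl hlen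
    have hT' : T = fun i => some (f ((boolFunEquivFin n).symm i)) :=
      (List.ofFn_injective hl).symm
    subst hT'
    refine (circuitSizeOver_le_of_computes C hC fun x => ?_).trans hsize
    simpa using hT (boolFunEquivFin n x) (f x) (by simp)
  · intro hf
    obtain ⟨C, hC, hCf, hCs⟩ := exists_computes_B2_size_eq f
    refine ⟨n, _, s, rfl, C, hC, hCs ▸ hf, ?_⟩
    rintro i b ⟨rfl⟩
    exact hCf _
-/

/-! ### Complexity upper bounds -/

/-- `MCSP ∈ NP`: guess a circuit of size `≤ s` (w.l.o.g. `s < 2ⁿ⁺¹`, else answer yes by the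
trivial DNF bound) and evaluate it on all `2ⁿ` inputs, in time polynomial in `|tt f| = 2ⁿ`
(Kabanets–Cai 2000, §2; Arora–Barak 2009, Ex. 6.6). [cite: KabanetsCai2000, §2] -/
def MCSP_mem_NP : Prop :=
  MCSP ∈ NP

/-- `MCSP* ∈ NP`: guess a circuit of size `≤ s` (w.l.o.g. `s = O(2ⁿ · n)`) and check it on the
defined entries of the partial truth table (Hirahara 2022, §1.1). [cite: Hirahara2022, §1.1] -/
def MCSPStar_mem_NP : Prop :=
  MCSPStar ∈ NP

end Literature.Computability.MetaComplexity
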